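import Summits.NavierStokesRegularity.NavierStokesRegularity.Theorems.FrozenSignCascadeBoundedEnvelopeContinuationLiouvilleAxisymmetric
import Summits.NavierStokesRegularity.NavierStokesRegularity.Theorems.FrozenSignCascadeBoundedEnvelopeContinuationShellSupBound
import HarnessLib

/-!
# Route FrozenSignCascade · crux `BoundedEnvelopeContinuation` — (L_M) holds in the axisymmetric
# class, unconditionally (discharge of the single-shell hypothesis)

Helper file for the crux item stmt-NavierStokesRegularity-10579 (`BoundedEnvelopeContinuation`,
conjunct (B) of route `FrozenSignCascade`), line `registered`; lands `--supports` that item: the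
registered sub-goal `liouvilleMorrey_axisymmetric`, i.e. `liouvilleMorrey_axisymmetric_of`
(`…LiouvilleAxisymmetric.lean`, p165977) with its hypothesis — the unit-scale single-shell sup
bound of Seregin–Zajaczkowski 2007, Prop. 4.1 for classical axisymmetric solutions — discharged by
`shellSupBound_of_abScaledSum` (`…ShellSupBound.lean`, p165902).

So the line's Liouville stub (Type-I exclusion in Liouville form for Morrey-bounded bounded ancient
mild solutions) is a THEOREM on axisymmetric solutions, complementing the small-constant regime
`liouvilleMorrey_small` (p160131); the general statement remains open.

References: G. Koch, N. Nadirashvili, G. Seregin, V. Šverák, Acta Math. 203 (2009), Thm. 5.3;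
G. Seregin, V. Šverák, Comm. PDE 34 (2009) = arXiv:0804.1803, Prop. 3.7; G. Seregin,
W. Zajaczkowski, SIAM J. Math. Anal. 39 (2007), Prop. 4.1.
-/

noncomputable section

set_option linter.dupNamespace false -- nested layout Summit.<S>.<Sub>, Sub = S (D-0017)

open Set MeasureTheory Filter Topology Metric Function
open Literature.Analysis Literature.Analysis.FluidPDE

namespace Summit.NavierStokesRegularity.NavierStokesRegularity.Theorems.BoundedEnvelope

/-- **(L_M) holds in the axisymmetric class, unconditionally.** A bounded ancient mild solution
`v` of Navier–Stokes (`ν = 1`) on `(-∞,0) × ℝ³`, jointly smooth and Oseen-mild there, whose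
slices obey the scale-invariant Morrey bound `∫_{B_r(y)} ‖v t‖² ≤ M' r` at ALL radii and are
AXISYMMETRIC (about the `x₃`-axis), vanishes identically: `liouvilleMorrey_axisymmetric_of`
with the single-shell sup bound discharged (`shellSupBound_of_abScaledSum`, Seregin–Zajaczkowski
2007, Prop. 4.1). This is the line's open Liouville stub restricted to axisymmetric solutions
(the general statement is Type-I exclusion in Liouville form).
[cite: KochNadirashviliSereginSverak2009, Thm. 5.3; SereginSverak2009, Prop. 3.7] -/
theorem liouvilleMorrey_axisymmetric :
    ∀ v : ℝ → EuclideanSpace ℝ (Fin 3) → EuclideanSpace ℝ (Fin 3),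
      Literature.Analysis.FluidPDE.IsBoundedAncientMildSolution 1 v →
      ContDiffOn ℝ (⊤ : ℕ∞) (uncurry v) (Set.Iio 0 ×ˢ Set.univ) →
      (∀ s t : ℝ, s < t → t < 0 → ∀ x,
        v t x = UnboundedOperators.heatExtension (v s) (t - s) x -
          Literature.Analysis.FluidPDE.oseenDuhamel 1 s v v t x) →
      (∃ M' : ℝ, ∀ t < 0, ∀ (y : EuclideanSpace ℝ (Fin 3)) (r : ℝ), 0 < r →
        ∫ x in Metric.ball y r, ‖v t x‖ ^ 2 ≤ M' * r) →
      (∀ t < 0, Literature.Analysis.FluidPDE.IsAxisymmetric (v t)) →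
      ∀ t < 0, ∀ x, v t x = 0 :=
  liouvilleMorrey_axisymmetric_of shellSupBound_of_abScaledSum

/-- **Corollary: (L_PM) holds in the axisymmetric class** (the r4 residue of the line on
axisymmetric solutions; the pseudo-measure hypothesis is not needed there). [cite: KochNadirashviliSereginSverak2009, Thm. 5.3] -/
theorem liouvillePM_axisymmetric :
    ∀ v : ℝ → EuclideanSpace ℝ (Fin 3) → EuclideanSpace ℝ (Fin 3),
      Literature.Analysis.FluidPDE.IsBoundedAncientMildSolution 1 v →
      ContDiffOn ℝ (⊤ : ℕ∞) (uncurry v) (Set.Iio 0 ×ˢ Set.univ) →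
      (∀ s t : ℝ, s < t → t < 0 → ∀ x,
        v t x = UnboundedOperators.heatExtension (v s) (t - s) x -
          Literature.Analysis.FluidPDE.oseenDuhamel 1 s v v t x) →
      (∃ M' : ℝ, ∀ t < 0, ∀ (y : EuclideanSpace ℝ (Fin 3)) (r : ℝ), 0 < r →
        ∫ x in Metric.ball y r, ‖v t x‖ ^ 2 ≤ M' * r) →
      (∃ C' : ℝ, ∀ t < 0, ∀ (l : Fin 3) (φ : EuclideanSpace ℝ (Fin 3) → ℝ),
        MeasureTheory.Integrable φ →
        MeasureTheory.Integrable (fun ξ : EuclideanSpace ℝ (Fin 3) =>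
          ‖FourierTransform.fourier (fun x => (φ x : ℂ)) ξ‖ / ‖ξ‖ ^ 2) →
        |∫ y, v t y l * φ y| ≤
          C' * ∫ ξ : EuclideanSpace ℝ (Fin 3), ‖FourierTransform.fourier (fun x => (φ x : ℂ)) ξ‖ / ‖ξ‖ ^ 2) →
      (∀ t < 0, Literature.Analysis.FluidPDE.IsAxisymmetric (v t)) →
      ∀ t < 0, ∀ x, v t x = 0 :=
  fun v hv hsm hoseen hM _ hax => liouvilleMorrey_axisymmetric v hv hsm hoseen hM hax

end Summit.NavierStokesRegularity.NavierStokesRegularity.Theorems.BoundedEnvelope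

end
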